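import Literature.AnabelianGeometry.SemiGraphs.PSCVertexQuotientNontrivialProofs
import Mathlib.Topology.Algebra.ClopenNhdofOne
import Mathlib.Topology.Algebra.Group.Pointwise
import Mathlib.Algebra.Group.Commutator
import Mathlib.Algebra.Group.Subgroup.ZPowers.Lemmas
import Mathlib.Data.Int.GCD
import Mathlib.Order.Zorn
import Mathlib.Tactic.Group
import HarnessLib

/-!
# [CombGC] Theorem 1.6 sub-DAG, row T16-L13: the converse half of the vertex-quotient characterization

[IUTchI] Remark 1.2.3 (iv) (kurims p. 42): "the elementary abelian quotients `φ : M^unr_G ↠ Q` whose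
restriction to `M^unr-vert_G` surjects onto `Q` and has the same kernel as the quotient
`M^unr-vert_G ↠ M^unr_G[v] ↠ M^unr_G[v] ⊗ F_l` … may be characterized as the maximal quotients [i.e.,
relative to the relation of domination] among those elementary abelian quotients of `M^unr_G` that
correspond to verticially purely totally ramified coverings of `G`."  The forward half of
`PSCDatum.VertexQuotientCharacterization` (`PSCGraphicitySub2.lean`) is
`vertexQuotientCharacterization_mp` (`PSCVertexQuotientProofs.lean`); this file PROVES the CONVERSE
half from the criterion `ElementaryQuotientVerticiallyRamifiedIff` and the COMPLEMENT clause of the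
split injection `UnrVerticialSplitInjection` (abc-iut-L3-t4, `PSCRamification.lean`), for profinite
`Π_G`, and assembles the row:

* the "twist" (`exists_le_sup_eq_top_inf_eq`, a private copy of abc-iut-w4-d052's
  `PrimeExponentComplement.lean`, by Zorn on subgroups): modulo a normal `N ⊇ [Π, Π]` containing all
  `l`-th powers (`l` prime), a subgroup `H ⊇ N` with `A ⊔ H = ⊤` contains a complement `S` of `A`
  modulo `N` (`A ⊔ S = ⊤`, `A ⊓ S = N`);
* `pow_mem_vertexQuotientKer` — `l`-th powers of `M^unr-vert_G` lie in `Ker_v`;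
* `vertexQuotientCharacterization_mpr` — **the converse implication**: if the kernel `H'` of a
  maximal verticially purely totally ramified elementary abelian quotient (ramified at `v`) met
  `M^unr-vert_G` in more than `Ker_v`, a complement taken inside `H'` modulo
  `N := Ker_v · (M^unr-vert_G ∩ U) · (C ∩ H')` (`C` the closed complement of `M^unr-vert_G`, `U ⊆ H'`
  a small open normal subgroup; `N` is open: closed of finite index) would be a strictly smaller
  such kernel;
* `vertexQuotientCharacterization_of_inputs` — both halves from `ElementaryQuotientVerticiallyRamifiedIff`,
  `UnrVerticialSplitInjection`, `UnrVertAbOfRank` (the `…Holds Ω` form follows in a companion file).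

Proof-only (0 defs); plain profinite group theory over the interface (no rank input is needed for
the converse half).  Nothing here takes a side on [IUTchIII] Cor. 3.12.
[cite: Mochizuki2012, IUTchI Rmk 1.2.3(iv) p.42] [cite: MochizukiCombGC2007, Thm 1.6(iii) p.14]
-/

noncomputable section

namespace Literature.AnabelianGeometry.SemiGraphs

namespace PSCDatum

open scoped Pointwise

universe u


/-! ### Elementary group theory (private copies of `PrimeExponentComplement.lean`) -/

section Algebra

open scoped commutatorElement

variable {Γ : Type u} [Group Γ]

/-- Bezout for a prime exponent (private copy). [folklore] -/
private theorem mem_of_pow_mem_of_zpow_mem {T : Subgroup Γ} {h : Γ} {l : ℕ} (hl : l.Prime) {k : ℤ}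
    (hk : ¬ (l : ℤ) ∣ k) (hlT : h ^ l ∈ T) (hkT : h ^ k ∈ T) : h ∈ T := by
  have hg : Int.gcd (l : ℤ) k = 1 := by
    have hdvd : Int.gcd (l : ℤ) k ∣ l := by
      have := Int.gcd_dvd_left (l : ℤ) k
      exact_mod_cast this
    rcases (Nat.dvd_prime hl).mp hdvd with h1 | h2
    · exact h1
    · exact absurd (h2 ▸ Int.gcd_dvd_right (l : ℤ) k) hk
  have key : ((l : ℤ) * Int.gcdA l k + k * Int.gcdB l k) = 1 := by
    have := Int.gcd_eq_gcd_ab (l : ℤ) k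
    rw [hg] at this
    exact_mod_cast this.symm
  have hh : h = (h ^ (l : ℤ)) ^ Int.gcdA l k * (h ^ k) ^ Int.gcdB l k := by
    rw [← zpow_mul, ← zpow_mul, ← zpow_add, key, zpow_one]
  rw [hh]
  exact mul_mem (Subgroup.zpow_mem _ (by rw [zpow_natCast]; exact hlT) _)
    (Subgroup.zpow_mem _ hkT _)

/-- `a ^ l, b ^ l ∈ K ⊇ [Γ, Γ] ⇒ (a b) ^ l ∈ K` (private copy). [folklore] -/
private theorem mul_pow_mem_of_commutator_le {K : Subgroup Γ} (hK : ⁅(⊤ : Subgroup Γ), ⊤⁆ ≤ K) (l : ℕ)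
    {a b : Γ} (ha : a ^ l ∈ K) (hb : b ^ l ∈ K) : (a * b) ^ l ∈ K := by
  haveI : K.Normal := normal_of_commutator_le hK
  haveI : IsMulCommutative (Γ ⧸ K) :=
    Subgroup.Normal.quotient_commutative_iff_commutator_le.mpr (by rwa [commutator_def])
  rw [← QuotientGroup.eq_one_iff] at ha hb ⊢
  rw [QuotientGroup.mk_pow] at ha hb
  have hc : Commute ((a : Γ ⧸ K)) (b : Γ ⧸ K) := mul_comm' _ _
  rw [QuotientGroup.mk_pow, QuotientGroup.mk_mul, hc.mul_pow, ha, hb, one_mul]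

/-- The twist: a complement of `A` modulo `N` inside `H` (private copy; see `PrimeExponentComplement`).
[folklore] [cite: Mochizuki2012, IUTchI Rmk 1.2.3(iv) p.42] -/
private theorem exists_le_sup_eq_top_inf_eq {N A H : Subgroup Γ} (hcomm : ⁅(⊤ : Subgroup Γ), ⊤⁆ ≤ N)
    {l : ℕ} (hl : l.Prime) (hpow : ∀ g : Γ, g ^ l ∈ N) (hNA : N ≤ A) (hNH : N ≤ H)
    (hAH : A ⊔ H = ⊤) : ∃ S : Subgroup Γ, N ≤ S ∧ S ≤ H ∧ A ⊔ S = ⊤ ∧ A ⊓ S = N := by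
  classical
  set 𝒮 : Set (Subgroup Γ) := {S | N ≤ S ∧ S ≤ H ∧ A ⊓ S = N} with h𝒮
  have hN𝒮 : N ∈ 𝒮 := ⟨le_rfl, hNH, inf_eq_right.mpr hNA⟩
  have hchain : ∀ c ⊆ 𝒮, IsChain (· ≤ ·) c → ∀ y ∈ c, ∃ ub ∈ 𝒮, ∀ z ∈ c, z ≤ ub := by
    intro c hc𝒮 hc y hy
    refine ⟨sSup c, ⟨(hc𝒮 hy).1.trans (le_sSup hy), sSup_le fun z hz => (hc𝒮 hz).2.1, ?_⟩,
      fun z hz => le_sSup hz⟩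
    refine le_antisymm ?_ (le_inf hNA ((hc𝒮 hy).1.trans (le_sSup hy)))
    rintro x ⟨hxA, hxc⟩
    obtain ⟨s, hs, hxs⟩ := (Subgroup.mem_sSup_of_directedOn ⟨y, hy⟩ hc.directedOn).mp hxc
    have hx : x ∈ A ⊓ s := ⟨hxA, hxs⟩
    rwa [(hc𝒮 hs).2.2] at hx
  obtain ⟨S, hNS, hSmax⟩ := zorn_le_nonempty₀ 𝒮 hchain N hN𝒮
  obtain ⟨-, hSH, hAS⟩ := hSmax.prop
  refine ⟨S, hNS, hSH, ?_, hAS⟩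
  by_contra htop
  have hHle : ¬ H ≤ A ⊔ S := fun hle =>
    htop (top_le_iff.mp (hAH.ge.trans (sup_le le_sup_left hle)))
  obtain ⟨h, hhH, hh⟩ := Set.not_subset.mp hHle
  haveI hSn : S.Normal := normal_of_commutator_le (hcomm.trans hNS)
  set S' : Subgroup Γ := S ⊔ Subgroup.zpowers h with hS'
  have hS'𝒮 : S' ∈ 𝒮 := by
    refine ⟨hNS.trans le_sup_left, sup_le hSH ((Subgroup.zpowers_le).mpr hhH),
      le_antisymm ?_ (le_inf hNA (hNS.trans le_sup_left))⟩
    rintro x ⟨hxA, hxS'⟩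
    have hx' : x ∈ ((S ⊔ Subgroup.zpowers h : Subgroup Γ) : Set Γ) := hxS'
    rw [Subgroup.normal_mul] at hx'
    obtain ⟨s, hs, t, ht, rfl⟩ := hx'
    obtain ⟨k, rfl⟩ := Subgroup.mem_zpowers_iff.mp ht
    have hkAS : h ^ k ∈ A ⊔ S := by
      have := mul_mem (Subgroup.mem_sup_right (inv_mem hs) : s⁻¹ ∈ A ⊔ S)
        (Subgroup.mem_sup_left hxA : s * h ^ k ∈ A ⊔ S)
      rwa [inv_mul_cancel_left] at this
    by_cases hdvd : (l : ℤ) ∣ k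
    · obtain ⟨m, rfl⟩ := hdvd
      have hkS : h ^ ((l : ℤ) * m) ∈ S := by
        rw [zpow_mul, zpow_natCast]
        exact Subgroup.zpow_mem _ (hNS (hpow h)) m
      have hx : s * h ^ ((l : ℤ) * m) ∈ A ⊓ S := ⟨hxA, mul_mem hs hkS⟩
      rwa [hAS] at hx
    · exact absurd (mem_of_pow_mem_of_zpow_mem hl hdvd
        (Subgroup.mem_sup_right (hNS (hpow h))) hkAS) hh
  have hEq : S = S' := hSmax.eq_of_le hS'𝒮 le_sup_left
  apply hh
  have hhS' : h ∈ S' := Subgroup.mem_sup_right (Subgroup.mem_zpowers h)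
  rw [← hEq] at hhS'
  exact Subgroup.mem_sup_right hhS'


end Algebra

/-! ### Bookkeeping on `Ker_v` -/

variable {P : Type u} [Group P] [TopologicalSpace P] [IsTopologicalGroup P]

/-- `E^unr_G ⊆ Ker_v`. [cite: Mochizuki2012, IUTchI Rmk 1.2.3(iv) p.42] -/
theorem unrAbKer_le_vertexQuotientKer (G : PSCDatum P) (l : ℕ) (v : G.graph.V) :
    G.unrAbKer ≤ G.vertexQuotientKer l v := by
  unfold vertexQuotientKer
  exact (le_sup_left.trans le_sup_left).trans (Subgroup.le_topologicalClosure _)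

/-- `[Π, Π] ⊆ Ker_v`. [cite: Mochizuki2012, IUTchI Rmk 1.2.3(iv) p.42] -/
theorem commutator_le_vertexQuotientKer (G : PSCDatum P) (l : ℕ) (v : G.graph.V) :
    ⁅(⊤ : Subgroup P), ⊤⁆ ≤ G.vertexQuotientKer l v :=
  G.commutator_le_unrAbKer.trans (G.unrAbKer_le_vertexQuotientKer l v)

/-- `M^unr_G[w] ⊆ Ker_v` for `w ≠ v` (preimages). [cite: Mochizuki2012, IUTchI Rmk 1.2.3(iv) p.42] -/
theorem unrVertAbOf_le_vertexQuotientKer (G : PSCDatum P) (l : ℕ) {v w : G.graph.V} (hw : w ≠ v) :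
    G.unrVertAbOf w ≤ G.vertexQuotientKer l v := by
  unfold vertexQuotientKer
  exact ((le_iSup (fun w : {w : G.graph.V // w ≠ v} => G.unrVertAbOf w.1) ⟨w, hw⟩).trans
    (le_sup_right.trans le_sup_left)).trans (Subgroup.le_topologicalClosure _)

/-- `Π_w ⊆ Ker_v` for `w ≠ v`. [cite: Mochizuki2012, IUTchI Rmk 1.2.3(iv) p.42] -/
theorem vertGp_le_vertexQuotientKer (G : PSCDatum P) (l : ℕ) {v w : G.graph.V} (hw : w ≠ v) :
    G.vertGp w ≤ G.vertexQuotientKer l v :=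
  (G.vertGp_le_unrVertAbOf w).trans (G.unrVertAbOf_le_vertexQuotientKer l hw)

/-- `Ker_v` is closed. [cite: Mochizuki2012, IUTchI Rmk 1.2.3(iv) p.42] -/
theorem isClosed_vertexQuotientKer (G : PSCDatum P) (l : ℕ) (v : G.graph.V) :
    IsClosed (G.vertexQuotientKer l v : Set P) := by
  unfold vertexQuotientKer
  exact Subgroup.isClosed_topologicalClosure _

/-- The `l`-th powers of `M^unr-vert_G` lie in `Ker_v` (preimages): the elements whose `l`-th power
lies in `Ker_v` form a closed subgroup containing every `M^unr_G[w]`.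
[cite: Mochizuki2012, IUTchI Rmk 1.2.3(iv) p.42] -/
theorem pow_mem_vertexQuotientKer (G : PSCDatum P) (l : ℕ) (v : G.graph.V) {a : P}
    (ha : a ∈ G.unrVertAb) : a ^ l ∈ G.vertexQuotientKer l v := by
  have hcomm := G.commutator_le_vertexQuotientKer l v
  let T : Subgroup P :=
    { carrier := {g | g ^ l ∈ G.vertexQuotientKer l v}
      mul_mem' := fun ha hb => mul_pow_mem_of_commutator_le hcomm l ha hb
      one_mem' := by simp only [Set.mem_setOf_eq, one_pow]; exact one_mem _
      inv_mem' := fun ha => by simp only [Set.mem_setOf_eq, inv_pow]; exact inv_mem ha }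
  have hTc : IsClosed (T : Set P) := (G.isClosed_vertexQuotientKer l v).preimage (continuous_pow l)
  have hle : G.unrVertAb ≤ T := by
    unfold unrVertAb
    refine Subgroup.topologicalClosure_minimal _ (iSup_le fun w => ?_) hTc
    intro g hg
    change g ^ l ∈ G.vertexQuotientKer l v
    by_cases hw : w = v
    · subst hw
      unfold vertexQuotientKer
      exact Subgroup.le_topologicalClosure _
        (Subgroup.mem_sup_right (Subgroup.subset_closure ⟨g, hg, rfl⟩))
    · exact pow_mem (G.unrVertAbOf_le_vertexQuotientKer l hw hg) l
  exact hle ha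

/-! ### The converse implication of `VertexQuotientCharacterization` -/

section Converse

variable [CompactSpace P]

/-- In a compact group the join of a closed normal subgroup and a closed subgroup is closed.
[cite: Mochizuki2012, IUTchI Rmk 1.2.3(iv) p.42] -/
theorem isClosed_sup_of_normal_left (N H : Subgroup P) [N.Normal] (hN : IsClosed (N : Set P))
    (hH : IsClosed (H : Set P)) : IsClosed ((N ⊔ H : Subgroup P) : Set P) := by
  rw [Subgroup.normal_mul]
  exact hH.mul_left_of_isCompact hN.isCompact

variable [TotallyDisconnectedSpace P]

/-- **Row T16-L13, converse implication of `PSCDatum.VertexQuotientCharacterization`** ([IUTchI]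
Rmk. 1.2.3 (iv), p. 42): for sturdy `G` of pro-`Σ` PSC-type on a profinite group, `Σ = {l}`, granted
the criterion `ElementaryQuotientVerticiallyRamifiedIff` and the split injection
`UnrVerticialSplitInjection` (its complement clause), an elementary abelian quotient of `M^unr_G`
which corresponds to a verticially purely totally ramified covering and is MAXIMAL among such
(minimal kernel `H'`) restricts to `M^unr-vert_G` onto (`M^unr-vert ⊔ H' = ⊤`) with kernel
`M^unr-vert ⊓ H' = Ker(M^unr-vert_G ↠ M^unr_G[v] ⊗ F_l)` for the vertex `v` over which it ramifies.
[cite: Mochizuki2012, IUTchI Rmk 1.2.3(iv) p.42] -/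
theorem vertexQuotientCharacterization_mpr (G : PSCDatum P)
    (hiff : G.ElementaryQuotientVerticiallyRamifiedIff) (hsplit : G.UnrVerticialSplitInjection)
    (hGs : G.IsSturdy) {l : ℕ} (hS : G.Sigma = {l})
    {H' : Subgroup P} (hH' : G.IsElemAbUnrQuotient l H')
    (hram : G.IsVerticiallyPurelyTotallyRamified ⊤ H')
    (hmax : ∀ H'' : Subgroup P, G.IsElemAbUnrQuotient l H'' →
      G.IsVerticiallyPurelyTotallyRamified ⊤ H'' → H'' ≤ H' → H'' = H') :
    ∃ v : G.graph.V, G.unrVertAb ⊔ H' = ⊤ ∧ G.unrVertAb ⊓ H' = G.vertexQuotientKer l v := by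
  have hl : l.Prime := G.sigma_prime l (by rw [hS]; exact Set.mem_singleton l)
  obtain ⟨hnorm, hopen, hEH, hpow⟩ := hH'
  haveI := hnorm
  obtain ⟨v, hvsup, hvw⟩ := (hiff hGs l H' hS hnorm hopen hEH hpow).mp hram
  set A : Subgroup P := G.unrVertAb with hA
  set K : Subgroup P := G.vertexQuotientKer l v with hK
  set E : Subgroup P := G.unrAbKer with hE
  have hsup : A ⊔ H' = ⊤ :=
    top_le_iff.mp (hvsup.ge.trans (sup_le_sup_right
      ((G.vertGp_le_unrVertAbOf v).trans (G.unrVertAbOf_le_unrVertAb v)) _))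
  refine ⟨v, hsup, ?_⟩
  have hKA : K ≤ A := G.vertexQuotientKer_le_unrVertAb l v
  have hKH : K ≤ H' := G.vertexQuotientKer_le_of_isElemAbUnrQuotient ⟨hnorm, hopen, hEH, hpow⟩ hvw
  refine le_antisymm ?_ (le_inf hKA hKH)
  by_contra hnot
  rw [SetLike.le_def] at hnot
  push Not at hnot
  obtain ⟨x, hxAH, hxK⟩ := hnot
  obtain ⟨hxA, hxH⟩ := Subgroup.mem_inf.mp hxAH
  obtain ⟨-, C, hCc, hEC, hCA, hCsup⟩ := hsplit hGs
  change C ⊓ A = E at hCA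
  change C ⊔ A = ⊤ at hCsup
  have hKc : IsClosed (K : Set P) := G.isClosed_vertexQuotientKer l v
  have hAc : IsClosed (A : Set P) := Subgroup.isClosed_topologicalClosure _
  have hH'c : IsClosed (H' : Set P) := Subgroup.isClosed_of_isOpen _ hopen
  have hcommE : ⁅(⊤ : Subgroup P), ⊤⁆ ≤ E := G.commutator_le_unrAbKer
  have hEK : E ≤ K := G.unrAbKer_le_vertexQuotientKer l v
  have hEA : E ≤ A := (G.unrAbKer_le_unrVertAbOf v).trans (G.unrVertAbOf_le_unrVertAb v)
  haveI hKn : K.Normal := normal_of_commutator_le (hcommE.trans hEK)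
  haveI hAn : A.Normal := normal_of_commutator_le (hcommE.trans hEA)
  have hO : IsOpen ({u : P | u * x⁻¹ ∈ (K : Set P)ᶜ} ∩ (H' : Set P)) :=
    (hKc.isOpen_compl.preimage (continuous_id.mul continuous_const)).inter hopen
  obtain ⟨U₀, hU₀⟩ := ProfiniteGrp.exist_openNormalSubgroup_sub_open_nhds_of_one hO
    ⟨by simpa using hxK, one_mem H'⟩
  set U : Subgroup P := (U₀ : Subgroup P) with hU
  have hUo : IsOpen (U : Set P) := U₀.isOpen
  have hUH : U ≤ H' := fun u hu => (hU₀ hu).2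
  have hUx : ∀ u ∈ U, u * x⁻¹ ∉ K := fun u hu => (hU₀ hu).1
  set K' : Subgroup P := K ⊔ (A ⊓ U) with hK'
  set W : Subgroup P := C ⊓ H' with hW
  set N : Subgroup P := K' ⊔ W with hN
  have hK'A : K' ≤ A := sup_le hKA inf_le_left
  have hK'H : K' ≤ H' := sup_le hKH (inf_le_right.trans hUH)
  have hxK' : x ∉ K' := by
    intro hx
    have hx' : x ∈ ((K ⊔ U : Subgroup P) : Set P) := (sup_le_sup_left inf_le_right K : K' ≤ K ⊔ U) hx
    rw [Subgroup.mul_normal] at hx'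
    obtain ⟨k, hk, u, hu, hux⟩ := hx'
    apply hUx u hu
    have hux' : u * x⁻¹ = k⁻¹ := by rw [← hux]; group
    rw [hux']
    exact inv_mem hk
  have hEK' : E ≤ K' := hEK.trans le_sup_left
  have hKN : K ≤ N := le_sup_left.trans le_sup_left
  have hEN : E ≤ N := hEK'.trans le_sup_left
  have hcommN : ⁅(⊤ : Subgroup P), ⊤⁆ ≤ N := hcommE.trans hEN
  haveI hNn : N.Normal := normal_of_commutator_le hcommN
  haveI hK'n : K'.Normal := normal_of_commutator_le (hcommE.trans hEK')
  have hNH : N ≤ H' := sup_le hK'H inf_le_right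
  have hpowN : ∀ g : P, g ^ l ∈ N := by
    intro g
    have hg : g ∈ ((C ⊔ A : Subgroup P) : Set P) := by rw [hCsup]; exact Subgroup.mem_top g
    rw [Subgroup.mul_normal] at hg
    obtain ⟨c, hc, a, ha, rfl⟩ := hg
    refine mul_pow_mem_of_commutator_le hcommN l ?_ ?_
    · exact Subgroup.mem_sup_right ⟨pow_mem hc l, hpow c⟩
    · exact hKN (G.pow_mem_vertexQuotientKer l v ha)
  have hAN : A ⊓ N ≤ K' := by
    rintro y ⟨hyA, hyN⟩
    have hy : y ∈ ((K' ⊔ W : Subgroup P) : Set P) := hyN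
    rw [Subgroup.normal_mul] at hy
    obtain ⟨k, hk, w, hw, rfl⟩ := hy
    have hwA : w ∈ A := by
      have := mul_mem (inv_mem (hK'A hk)) hyA
      rwa [inv_mul_cancel_left] at this
    have hwE : w ∈ E := by rw [← hCA]; exact ⟨hw.1, hwA⟩
    exact mul_mem hk (hEK' hwE)
  have hUc : IsClosed (U : Set P) := Subgroup.isClosed_of_isOpen _ hUo
  have hK'c : IsClosed (K' : Set P) := isClosed_sup_of_normal_left K (A ⊓ U) hKc (hAc.inter hUc)
  have hWc : IsClosed (W : Set P) := hCc.inter hH'c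
  have hNc : IsClosed (N : Set P) := isClosed_sup_of_normal_left K' W hK'c hWc
  haveI hUfi : U.FiniteIndex := finiteIndex_of_isOpen U hUo
  haveI hH'fi : H'.FiniteIndex := finiteIndex_of_isOpen H' hopen
  have h1 : (A ⊓ U).relIndex A ≠ 0 := by
    rw [inf_comm, Subgroup.inf_relIndex_right]
    exact fun h => hUfi.index_ne_zero
      (Nat.eq_zero_of_zero_dvd (h ▸ Subgroup.relIndex_dvd_index_of_normal U A))
  have h2 : N.relIndex A ≠ 0 := fun h =>
    h1 (Subgroup.relIndex_eq_zero_of_le_left (le_sup_right.trans le_sup_left : A ⊓ U ≤ N) h)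
  have h3 : W.relIndex C ≠ 0 := by
    rw [hW, inf_comm, Subgroup.inf_relIndex_right]
    exact fun h => hH'fi.index_ne_zero
      (Nat.eq_zero_of_zero_dvd (h ▸ Subgroup.relIndex_dvd_index_of_normal H' C))
  haveI hAWn : (A ⊔ W).Normal := normal_of_commutator_le (hcommE.trans (hEA.trans le_sup_left))
  have hCAW : C ⊔ (A ⊔ W) = ⊤ :=
    top_le_iff.mp (hCsup.ge.trans (sup_le_sup_left le_sup_left C))
  have h4 : (A ⊔ W).index ≠ 0 := by
    rw [← Subgroup.relIndex_top_right, ← hCAW, Subgroup.relIndex_sup_right]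
    exact fun h => h3 (Subgroup.relIndex_eq_zero_of_le_left le_sup_right h)
  have h5 : N.index ≠ 0 := by
    rw [← Subgroup.relIndex_mul_index (le_sup_right : N ≤ A ⊔ N), Subgroup.relIndex_sup_right]
    refine mul_ne_zero h2 fun h => h4 (Nat.eq_zero_of_zero_dvd ?_)
    exact h ▸ Subgroup.index_dvd_of_le (sup_le_sup_left (le_sup_right : W ≤ N) A)
  haveI : N.FiniteIndex := ⟨h5⟩
  have hNo : IsOpen (N : Set P) := Subgroup.isOpen_of_isClosed_of_finiteIndex N hNc
  obtain ⟨S, hNS, hSH, hASsup, hASinf⟩ :=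
    exists_le_sup_eq_top_inf_eq (N := N) (A := A ⊔ N) (H := H') hcommN hl hpowN le_sup_right hNH
      (by rw [sup_assoc, sup_eq_right.mpr hNH, hsup])
  have hSo : IsOpen (S : Set P) := Subgroup.isOpen_mono hNS hNo
  haveI hSn : S.Normal := normal_of_commutator_le (hcommN.trans hNS)
  have hES : E ≤ S := hEN.trans hNS
  have hSel : G.IsElemAbUnrQuotient l S := ⟨hSn, hSo, hES, fun g => hNS (hpowN g)⟩
  have hSram : G.IsVerticiallyPurelyTotallyRamified ⊤ S := by
    refine (hiff hGs l S hS hSn hSo hES (fun g => hNS (hpowN g))).mpr ⟨v, ?_, fun w hw => ?_⟩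
    · refine top_le_iff.mp ?_
      have hVo : IsOpen ((G.vertGp v ⊔ S : Subgroup P) : Set P) :=
        Subgroup.isOpen_mono le_sup_right hSo
      have hA_le : A ≤ G.vertGp v ⊔ S :=
        G.unrVertAb_le_of_forall_vertGp_le hVo (hES.trans le_sup_right) fun w => by
          by_cases hwv : w = v
          · subst hwv; exact le_sup_left
          · exact ((G.vertGp_le_vertexQuotientKer l hwv).trans (hKN.trans hNS)).trans le_sup_right
      rw [← hASsup]
      exact sup_le (sup_le hA_le (hNS.trans le_sup_right)) le_sup_right
    · exact (G.vertGp_le_vertexQuotientKer l hw).trans (hKN.trans hNS)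
  have hSeq : S = H' := hmax S hSel hSram hSH
  have hxN : x ∈ N := by
    rw [← hASinf]
    exact ⟨Subgroup.mem_sup_left hxA, hSeq ▸ hxH⟩
  exact hxK' (hAN ⟨hxA, hxN⟩)

/-- **Row T16-L13: `PSCDatum.VertexQuotientCharacterization` from its inputs** — both halves of
[IUTchI] Rmk. 1.2.3 (iv)'s displayed characterization, for data on a profinite group: forward by
`vertexQuotientCharacterization_mp` (criterion + "[nontrivial!]", the latter from the independence
clause of the split injection and the rank of `M^unr_G[v]`), converse by
`vertexQuotientCharacterization_mpr` (criterion + complement clause).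
[cite: Mochizuki2012, IUTchI Rmk 1.2.3(iv) p.42] -/
theorem vertexQuotientCharacterization_of_inputs [T2Space P] (G : PSCDatum P)
    (hiff : G.ElementaryQuotientVerticiallyRamifiedIff) (hsplit : G.UnrVerticialSplitInjection)
    (hrank : G.UnrVertAbOfRank) : G.VertexQuotientCharacterization := by
  intro hGs l hS H' hH'
  have hlS : l ∈ G.Sigma := by rw [hS]; exact Set.mem_singleton l
  have hK : ∀ v : G.graph.V, G.vertexQuotientKer l v ≠ G.unrVertAb := fun v =>
    G.vertexQuotientKer_ne_unrVertAb hsplit hrank hGs hlS v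
  constructor
  · exact fun h => G.vertexQuotientCharacterization_mp hiff hGs hS hK hH' h
  · rintro ⟨hram, hmax⟩
    exact G.vertexQuotientCharacterization_mpr hiff hsplit hGs hS hH' hram hmax

end Converse

end PSCDatum

end Literature.AnabelianGeometry.SemiGraphs

end
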